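import Mathlib
import HarnessLib
import Summits.Ventures.LatticeQCDFlow.Exactness.IMHKernel

/-!
# Metropolis with a symmetric proposal KERNEL on a general state space; random walks on a group

HONEST FRAMING: exact (Metropolis-corrected) sampling algorithms for lattice gauge theory;
figures of merit are autocorrelation/cost numbers at stated couplings and volumes; no
continuum-physics claim.

Venture `LatticeQCDFlow` (cell pub-lqcd), topic `Exactness`, FANOUT row 9 (eng-latcore, the
engine `latflow.core`).  NEW WORK of the cell over Mathlib's Markov-kernel library; nothing here
is cited as a fact.  Printed counterparts, named only: Metropolis–Rosenbluth–Rosenbluth–Teller–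
Teller 1953, Tierney 1998 §2 (reversibility of Metropolis–Hastings kernels on general spaces),
Creutz 1980 / Cabibbo–Marinari 1982 era link updates ("hit the link with a random group element
near the identity, accept with `min(1, e^{−ΔS})`").

`IMHKernel.lean` (row 30) types the INDEPENDENCE sampler (proposal = a fixed law `q`, the flow).
The engine's other Metropolis updates propose from the CURRENT state: the N-hit link update of
`latflow.core.updates.metropolis` (`U ↦ X U`, `X` Haar-symmetric near `1`), the sequential
site Metropolis of `phi4_2d` (`φ ↦ φ + δ u`), and generally any symmetric random walk.  This file
types that case: a proposal KERNEL `P`, symmetric with respect to the reference measure.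

## Content (reference measure `vol`, unnormalised target density `p > 0`, `π = p · vol`)

* `symAcceptMass P p x = ∫ min(1, p y / p x) P(x, dy)`; `symMH P p : Kernel Ω Ω` — from `x`
  propose `y ∼ P(x, ·)`, accept with `min {1, p y / p x}` (the acceptance function IS
  `IMHKernel.imhAccept p`, reused), else stay; `symMH_apply`, `instIsMarkovKernelSymMH`.
* `symMH_isReversible` — if `P` is `vol`-SYMMETRIC, stated as the swap-invariance of the
  composite measure `(vol ⊗ₘ P).map Prod.swap = vol ⊗ₘ P` ("`vol(dx) P(x, dy)` is symmetric in
  `(x, y)`"), then `symMH P p` is reversible for `π = p · vol` (Mathlib `Kernel.IsReversible`),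
  for EVERY measurable `p > 0`; `symMH_invariant` — `π` is invariant.  Mechanism:
  `p(x) min(1, p(y)/p(x)) = min(p x, p y)` is symmetric and `Measure.setLIntegral_compProd` +
  `setLIntegral_map` move the swap onto the hypothesis.
* §2 the instance the engine runs: on a measurable group `G` with a LEFT-invariant `μ` (Haar on
  `SU(N)` / `U(1)`, Lebesgue on `ℝ` for `φ⁴`) the multiplicative random walk
  `mulWalk ρ : U ↦ law of X * U`, `X ∼ ρ`, is `μ`-symmetric as soon as the step law `ρ` is
  INVERSION-invariant (`ρ.map (·⁻¹) = ρ`): `lintegral_mulWalk`, `compProd_mulWalk_swap`;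
  hence `mulWalkMH_isReversible`: the Metropolis link update is exact for `e^{−S} · Haar` for every
  measurable action and every symmetric hit size (the hit size only moves the acceptance).

Not here: the N-hit composition (a composition of `π`-reversible kernels is `π`-invariant —
`SequentialScanAdjoint.lean`), ergodicity, optimal scaling of the step.
-/

namespace Summit.Ventures.LatticeQCDFlow.Exactness

open MeasureTheory ProbabilityTheory
open scoped ENNReal

variable {Ω : Type*} [MeasurableSpace Ω]

/-! ## §1 The Metropolis kernel with a proposal kernel -/

/-- Total acceptance mass from `x`: `A(x) = ∫ min(1, p y / p x) P(x, dy)`. -/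
noncomputable def symAcceptMass (P : Kernel Ω Ω) (p : Ω → ℝ) (x : Ω) : ℝ≥0∞ :=
  ∫⁻ y, imhAcceptE p x y ∂(P x)

/-- Measurability of the acceptance mass (s-finite proposal kernel). -/
theorem measurable_symAcceptMass (P : Kernel Ω Ω) [IsSFiniteKernel P] {p : Ω → ℝ}
    (hp : Measurable p) : Measurable (symAcceptMass P p) :=
  (measurable_imhAcceptE hp).lintegral_kernel_prod_right

/-- The acceptance mass is at most one for a Markov proposal kernel. -/
theorem symAcceptMass_le_one (P : Kernel Ω Ω) [IsMarkovKernel P] (p : Ω → ℝ) (x : Ω) :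
    symAcceptMass P p x ≤ 1 := by
  unfold symAcceptMass
  calc ∫⁻ y, imhAcceptE p x y ∂(P x) ≤ ∫⁻ _, 1 ∂(P x) := lintegral_mono fun y => imhAcceptE_le_one p x y
    _ = 1 := by rw [lintegral_const, measure_univ, mul_one]

/-- **Metropolis kernel with proposal kernel `P`.**  From `x`: propose `y ∼ P(x, ·)`, accept with
probability `min {1, p(y)/p(x)}`, otherwise stay at `x`:
`K(x, dy) = a(x, y) P(x, dy) + (1 − ∫ a(x, y') P(x, dy')) δ_x(dy)`. -/
noncomputable def symMH (P : Kernel Ω Ω) [IsSFiniteKernel P] (p : Ω → ℝ) : Kernel Ω Ω :=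
  Kernel.withDensity P (imhAcceptE p) +
    Kernel.withDensity (Kernel.deterministic id measurable_id) (fun x _ => 1 - symAcceptMass P p x)

variable {P : Kernel Ω Ω} [IsSFiniteKernel P] {p : Ω → ℝ}

/-- Set-wise formula: `K(x, B) = ∫_B a(x, y) P(x, dy) + (1 − A(x)) · 1_B(x)`. -/
theorem symMH_apply (hp : Measurable p) (x : Ω) {B : Set Ω} (hB : MeasurableSet B) :
    symMH P p x B =
      ∫⁻ y in B, imhAcceptE p x y ∂(P x) + (1 - symAcceptMass P p x) * B.indicator 1 x := by
  have h2 : Measurable (Function.uncurry fun (x : Ω) (_ : Ω) => 1 - symAcceptMass P p x) :=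
    measurable_const.sub ((measurable_symAcceptMass P hp).comp measurable_fst)
  rw [symMH, Kernel.add_apply, Measure.add_apply,
    Kernel.withDensity_apply' _ (measurable_imhAcceptE hp),
    Kernel.withDensity_apply' _ h2, Kernel.deterministic_apply, setLIntegral_const, id,
    Measure.dirac_apply' x hB]

/-- The Metropolis kernel is a Markov kernel when the proposal is. -/
instance instIsMarkovKernelSymMH [IsMarkovKernel P] [Fact (Measurable p)] :
    IsMarkovKernel (symMH P p) := by
  refine ⟨fun x => ⟨?_⟩⟩
  rw [symMH_apply (Fact.out) x MeasurableSet.univ, Measure.restrict_univ, Set.indicator_univ,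
    Pi.one_apply, mul_one]
  exact add_tsub_cancel_of_le (symAcceptMass_le_one P p x)

/-! ### Reversibility for a `vol`-symmetric proposal -/

/-- The mass flow `∫_A K(x, B) dπ(x)` for `π = p · vol`, split into the proposal part (an
integral of the SYMMETRISED weight `min(p x, p y)` against `vol(dx) P(x, dy)` over `A × B`) and the
diagonal rejection part over `A ∩ B`. -/
theorem setLIntegral_symMH {vol : Measure Ω} (hp : Measurable p) (hp0 : ∀ x, 0 < p x)
    {A B : Set Ω} (hA : MeasurableSet A) (hB : MeasurableSet B) :
    ∫⁻ x in A, symMH P p x B ∂(vol.withDensity fun x => ENNReal.ofReal (p x)) =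
      (∫⁻ x in A, ∫⁻ y in B, ENNReal.ofReal (min (p x) (p y)) ∂(P x) ∂vol) +
        ∫⁻ x in B ∩ A, ENNReal.ofReal (p x) * (1 - symAcceptMass P p x) ∂vol := by
  have hd : Measurable fun x => ENNReal.ofReal (p x) := hp.ennreal_ofReal
  have hK : Measurable fun x => symMH P p x B := Kernel.measurable_coe _ hB
  have hR : Measurable fun x => 1 - symAcceptMass P p x :=
    measurable_const.sub (measurable_symAcceptMass P hp)
  rw [setLIntegral_withDensity_eq_setLIntegral_mul _ hd hK hA]
  simp only [Pi.mul_apply]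
  have hpt : ∀ x, ENNReal.ofReal (p x) * symMH P p x B =
      ENNReal.ofReal (p x) * ∫⁻ y in B, imhAcceptE p x y ∂(P x) +
        B.indicator (fun x => ENNReal.ofReal (p x) * (1 - symAcceptMass P p x)) x := by
    intro x
    rw [symMH_apply hp x hB, mul_add]
    congr 1
    by_cases hx : x ∈ B
    · rw [Set.indicator_of_mem hx, Set.indicator_of_mem hx, Pi.one_apply, mul_one]
    · rw [Set.indicator_of_notMem hx, Set.indicator_of_notMem hx, mul_zero, mul_zero]
  simp_rw [hpt]
  have hind : Measurable
      (B.indicator fun x => ENNReal.ofReal (p x) * (1 - symAcceptMass P p x)) :=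
    (hd.mul hR).indicator hB
  rw [lintegral_add_right _ hind, lintegral_indicator hB, Measure.restrict_restrict hB]
  congr 1
  refine lintegral_congr fun x => ?_
  rw [← lintegral_const_mul _ ((measurable_imhAcceptE hp).of_uncurry_left)]
  refine lintegral_congr fun y => ?_
  exact ofReal_mul_imhAcceptE hp0 x y

/-- **Symmetric-proposal Metropolis is exact.**  If the proposal kernel `P` is symmetric with
respect to `vol` — the composite measure `vol(dx) P(x, dy)` on `Ω × Ω` is invariant under the
swap `(x, y) ↦ (y, x)` — then for EVERY measurable density `p > 0` the Metropolis kernel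
`symMH P p` is reversible with respect to `π = p · vol` (Mathlib's `Kernel.IsReversible`). -/
theorem symMH_isReversible {vol : Measure Ω} [SFinite vol] (hp : Measurable p) (hp0 : ∀ x, 0 < p x)
    (hP : (vol ⊗ₘ P).map Prod.swap = vol ⊗ₘ P) :
    Kernel.IsReversible (symMH P p) (vol.withDensity fun x => ENNReal.ofReal (p x)) := by
  intro A B hA hB
  rw [setLIntegral_symMH hp hp0 hA hB, setLIntegral_symMH hp hp0 hB hA, Set.inter_comm]
  congr 1
  have hs : Measurable fun z : Ω × Ω => ENNReal.ofReal (min (p z.1) (p z.2)) :=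
    ((hp.comp measurable_fst).min (hp.comp measurable_snd)).ennreal_ofReal
  have e1 : ∫⁻ x in A, ∫⁻ y in B, ENNReal.ofReal (min (p x) (p y)) ∂(P x) ∂vol =
      ∫⁻ z in A ×ˢ B, ENNReal.ofReal (min (p z.1) (p z.2)) ∂(vol ⊗ₘ P) :=
    (Measure.setLIntegral_compProd hs hA hB).symm
  have e2 : ∫⁻ x in B, ∫⁻ y in A, ENNReal.ofReal (min (p x) (p y)) ∂(P x) ∂vol =
      ∫⁻ z in B ×ˢ A, ENNReal.ofReal (min (p z.1) (p z.2)) ∂(vol ⊗ₘ P) :=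
    (Measure.setLIntegral_compProd hs hB hA).symm
  rw [e1, e2]
  conv_rhs => rw [← hP]
  rw [setLIntegral_map (hB.prod hA) hs measurable_swap, Set.preimage_swap_prod]
  refine setLIntegral_congr_fun (hA.prod hB) (fun z _ => ?_)
  rw [Prod.fst_swap, Prod.snd_swap, min_comm]

/-- **Exactness**: `π = p · vol` is invariant under the symmetric-proposal Metropolis kernel. -/
theorem symMH_invariant {vol : Measure Ω} [SFinite vol] [IsMarkovKernel P] (hp : Measurable p)
    (hp0 : ∀ x, 0 < p x) (hP : (vol ⊗ₘ P).map Prod.swap = vol ⊗ₘ P) :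
    Kernel.Invariant (symMH P p) (vol.withDensity fun x => ENNReal.ofReal (p x)) := by
  haveI : Fact (Measurable p) := ⟨hp⟩
  exact (symMH_isReversible hp hp0 hP).invariant

/-! ## §2 The multiplicative random walk on a group is Haar-symmetric -/

section GroupWalk

variable {G : Type*} [Group G] [MeasurableSpace G] [MeasurableMul₂ G]

/-- The **multiplicative random-walk proposal**: from `U` propose `X * U` with `X ∼ ρ` (the link
"hit" of a Metropolis update; `ρ` = law of the random group element near the identity). -/
noncomputable def mulWalk (ρ : Measure G) : Kernel G G :=
  Kernel.map (Kernel.const G ρ ×ₖ Kernel.deterministic id measurable_id) (fun z : G × G => z.1 * z.2)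

/-- The random-walk proposal is an s-finite kernel. -/
instance instIsSFiniteKernelMulWalk (ρ : Measure G) [SFinite ρ] : IsSFiniteKernel (mulWalk ρ) := by
  unfold mulWalk; infer_instance

/-- The random-walk proposal is a Markov kernel for a probability step law. -/
instance instIsMarkovKernelMulWalk (ρ : Measure G) [IsProbabilityMeasure ρ] :
    IsMarkovKernel (mulWalk ρ) := by
  unfold mulWalk; exact Kernel.IsMarkovKernel.map _ measurable_mul

/-- Integration against the proposal: `∫ g d(mulWalk ρ U) = ∫ g (X * U) ρ(dX)`. -/
theorem lintegral_mulWalk (ρ : Measure G) [SFinite ρ] (U : G) {g : G → ℝ≥0∞} (hg : Measurable g) :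
    ∫⁻ y, g y ∂(mulWalk ρ U) = ∫⁻ X, g (X * U) ∂ρ := by
  rw [mulWalk, Kernel.map_apply _ measurable_mul, Kernel.prod_apply, Kernel.const_apply,
    Kernel.deterministic_apply, lintegral_map hg measurable_mul,
    lintegral_prod (fun z : G × G => g (z.1 * z.2)) (hg.comp measurable_mul).aemeasurable]
  refine lintegral_congr fun X => ?_
  show ∫⁻ y, (fun y => g (X * y)) y ∂(Measure.dirac (id U)) = g (X * U)
  exact lintegral_dirac' (id U) (hg.comp (measurable_const_mul X))

/-- **Haar-symmetry of the random walk.**  If `μ` is LEFT-invariant and the step law `ρ` is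
invariant under inversion, then `μ(dU) · law(X * U)(dV)` is symmetric in `(U, V)`:
substitute `U ↦ X⁻¹ V` (left-invariance) and `X ↦ X⁻¹` (inversion-invariance). -/
theorem compProd_mulWalk_swap [MeasurableInv G] (μ ρ : Measure G) [SFinite μ] [SFinite ρ]
    [μ.IsMulLeftInvariant] [ρ.IsInvInvariant] :
    (μ ⊗ₘ mulWalk ρ).map Prod.swap = μ ⊗ₘ mulWalk ρ := by
  refine Measure.ext_of_lintegral _ (fun f hf => ?_)
  rw [lintegral_map hf measurable_swap,
    Measure.lintegral_compProd (f := fun z : G × G => f z.swap) (hf.comp measurable_swap),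
    Measure.lintegral_compProd hf]
  show ∫⁻ U, ∫⁻ y, f (y, U) ∂(mulWalk ρ U) ∂μ = ∫⁻ U, ∫⁻ y, f (U, y) ∂(mulWalk ρ U) ∂μ
  have h1 : ∀ U, ∫⁻ y, f (y, U) ∂(mulWalk ρ U) = ∫⁻ X, f (X * U, U) ∂ρ := fun U =>
    lintegral_mulWalk ρ U (g := fun y => f (y, U)) (hf.comp (measurable_id.prodMk measurable_const))
  have h2 : ∀ U, ∫⁻ y, f (U, y) ∂(mulWalk ρ U) = ∫⁻ X, f (U, X * U) ∂ρ := fun U =>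
    lintegral_mulWalk ρ U (g := fun y => f (U, y)) (hf.comp measurable_prodMk_left)
  simp_rw [h1, h2]
  have hm1 : Measurable (Function.uncurry fun (U X : G) => f (X * U, U)) :=
    hf.comp ((measurable_snd.mul measurable_fst).prodMk measurable_fst)
  have hm2 : Measurable (Function.uncurry fun (U X : G) => f (U, X * U)) :=
    hf.comp (measurable_fst.prodMk (measurable_snd.mul measurable_fst))
  rw [lintegral_lintegral_swap hm1.aemeasurable, lintegral_lintegral_swap hm2.aemeasurable]
  -- left-invariance in the inner `μ`-integral: `U ↦ X⁻¹ * V`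
  have h3 : ∀ X, ∫⁻ U, f (X * U, U) ∂μ = ∫⁻ V, f (V, X⁻¹ * V) ∂μ := fun X => by
    have := lintegral_mul_left_eq_self (μ := μ) (fun V => f (V, X⁻¹ * V)) X
    simp only [inv_mul_cancel_left] at this
    exact this
  simp_rw [h3]
  -- inversion-invariance in the outer `ρ`-integral: `X ↦ X⁻¹`
  have h4 : ∫⁻ X, ∫⁻ V, f (V, X⁻¹ * V) ∂μ ∂ρ = ∫⁻ X, ∫⁻ V, f (V, X * V) ∂μ ∂ρ :=
    lintegral_inv_eq_self (μ := ρ) (fun X => ∫⁻ V, f (V, X * V) ∂μ)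
  rw [h4]

/-- **The Metropolis link update is exact.**  On a measurable group with a left-invariant
reference measure `μ` (Haar), for EVERY inversion-symmetric probability step law `ρ`, every
measurable `p > 0` (e.g. `p = e^{−S}` for any measurable action): proposing `U ↦ X U`, `X ∼ ρ`,
and accepting with `min {1, p(XU)/p(U)}` is reversible for `p · μ` — whatever the hit size. -/
theorem mulWalkMH_isReversible [MeasurableInv G] {μ : Measure G} [SFinite μ] [μ.IsMulLeftInvariant]
    {ρ : Measure G} [IsProbabilityMeasure ρ] [ρ.IsInvInvariant] {p : G → ℝ} (hp : Measurable p)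
    (hp0 : ∀ U, 0 < p U) :
    Kernel.IsReversible (symMH (mulWalk ρ) p) (μ.withDensity fun U => ENNReal.ofReal (p U)) :=
  symMH_isReversible hp hp0 (compProd_mulWalk_swap μ ρ)

/-- … and `p · μ` is invariant under the Metropolis link update. -/
theorem mulWalkMH_invariant [MeasurableInv G] {μ : Measure G} [SFinite μ] [μ.IsMulLeftInvariant]
    {ρ : Measure G} [IsProbabilityMeasure ρ] [ρ.IsInvInvariant] {p : G → ℝ} (hp : Measurable p)
    (hp0 : ∀ U, 0 < p U) :
    Kernel.Invariant (symMH (mulWalk ρ) p) (μ.withDensity fun U => ENNReal.ofReal (p U)) :=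
  symMH_invariant hp hp0 (compProd_mulWalk_swap μ ρ)

end GroupWalk

/-! ## §3 The additive random walk (`φ ↦ u + φ`): scalar-field site Metropolis

(Appended 2026-08-21 by row 9 gen-6.)  The additive twin of §2, written out (Mathlib's
`to_additive` does not transport the `Kernel` vocabulary): positions in an additive group with a
LEFT-translation-invariant `μ` (Lebesgue on `ℝ` — the `phi4_2d` sequential Metropolis
`φ_x ↦ φ_x + δ u`, `u` symmetric), step law `ρ` invariant under `u ↦ −u`. -/

section AddGroupWalk

variable {G : Type*} [AddGroup G] [MeasurableSpace G] [MeasurableAdd₂ G]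

/-- The **additive random-walk proposal**: from `φ` propose `u + φ` with `u ∼ ρ`. -/
noncomputable def addWalk (ρ : Measure G) : Kernel G G :=
  Kernel.map (Kernel.const G ρ ×ₖ Kernel.deterministic id measurable_id) (fun z : G × G => z.1 + z.2)

/-- The additive random-walk proposal is an s-finite kernel. -/
instance instIsSFiniteKernelAddWalk (ρ : Measure G) [SFinite ρ] : IsSFiniteKernel (addWalk ρ) := by
  unfold addWalk; infer_instance

/-- The additive random-walk proposal is a Markov kernel for a probability step law. -/
instance instIsMarkovKernelAddWalk (ρ : Measure G) [IsProbabilityMeasure ρ] :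
    IsMarkovKernel (addWalk ρ) := by
  unfold addWalk; exact Kernel.IsMarkovKernel.map _ measurable_add

/-- Integration against the proposal: `∫ g d(addWalk ρ φ) = ∫ g (u + φ) ρ(du)`. -/
theorem lintegral_addWalk (ρ : Measure G) [SFinite ρ] (φ : G) {g : G → ℝ≥0∞} (hg : Measurable g) :
    ∫⁻ y, g y ∂(addWalk ρ φ) = ∫⁻ u, g (u + φ) ∂ρ := by
  rw [addWalk, Kernel.map_apply _ measurable_add, Kernel.prod_apply, Kernel.const_apply,
    Kernel.deterministic_apply, lintegral_map hg measurable_add,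
    lintegral_prod (fun z : G × G => g (z.1 + z.2)) (hg.comp measurable_add).aemeasurable]
  refine lintegral_congr fun u => ?_
  show ∫⁻ y, (fun y => g (u + y)) y ∂(Measure.dirac (id φ)) = g (u + φ)
  exact lintegral_dirac' (id φ) (hg.comp (measurable_const_add u))

/-- **Translation-symmetry of the additive walk.**  If `μ` is left-translation-invariant and the
step law `ρ` is invariant under negation, `μ(dφ) · law(u + φ)(dψ)` is symmetric in `(φ, ψ)`. -/
theorem compProd_addWalk_swap [MeasurableNeg G] (μ ρ : Measure G) [SFinite μ] [SFinite ρ]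
    [μ.IsAddLeftInvariant] [ρ.IsNegInvariant] :
    (μ ⊗ₘ addWalk ρ).map Prod.swap = μ ⊗ₘ addWalk ρ := by
  refine Measure.ext_of_lintegral _ (fun f hf => ?_)
  rw [lintegral_map hf measurable_swap,
    Measure.lintegral_compProd (f := fun z : G × G => f z.swap) (hf.comp measurable_swap),
    Measure.lintegral_compProd hf]
  show ∫⁻ φ, ∫⁻ y, f (y, φ) ∂(addWalk ρ φ) ∂μ = ∫⁻ φ, ∫⁻ y, f (φ, y) ∂(addWalk ρ φ) ∂μ
  have h1 : ∀ φ, ∫⁻ y, f (y, φ) ∂(addWalk ρ φ) = ∫⁻ u, f (u + φ, φ) ∂ρ := fun φ =>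
    lintegral_addWalk ρ φ (g := fun y => f (y, φ)) (hf.comp (measurable_id.prodMk measurable_const))
  have h2 : ∀ φ, ∫⁻ y, f (φ, y) ∂(addWalk ρ φ) = ∫⁻ u, f (φ, u + φ) ∂ρ := fun φ =>
    lintegral_addWalk ρ φ (g := fun y => f (φ, y)) (hf.comp measurable_prodMk_left)
  simp_rw [h1, h2]
  have hm1 : Measurable (Function.uncurry fun (φ u : G) => f (u + φ, φ)) :=
    hf.comp ((measurable_snd.add measurable_fst).prodMk measurable_fst)
  have hm2 : Measurable (Function.uncurry fun (φ u : G) => f (φ, u + φ)) :=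
    hf.comp (measurable_fst.prodMk (measurable_snd.add measurable_fst))
  rw [lintegral_lintegral_swap hm1.aemeasurable, lintegral_lintegral_swap hm2.aemeasurable]
  have h3 : ∀ u, ∫⁻ φ, f (u + φ, φ) ∂μ = ∫⁻ ψ, f (ψ, -u + ψ) ∂μ := fun u => by
    have := lintegral_add_left_eq_self (μ := μ) (fun ψ => f (ψ, -u + ψ)) u
    simp only [neg_add_cancel_left] at this
    exact this
  simp_rw [h3]
  have h4 : ∫⁻ u, ∫⁻ ψ, f (ψ, -u + ψ) ∂μ ∂ρ = ∫⁻ u, ∫⁻ ψ, f (ψ, u + ψ) ∂μ ∂ρ :=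
    lintegral_neg_eq_self (μ := ρ) (fun u => ∫⁻ ψ, f (ψ, u + ψ) ∂μ)
  rw [h4]

/-- **The scalar-field site Metropolis is exact.**  On an additive measurable group with a
left-translation-invariant `μ` (Lebesgue), for EVERY negation-symmetric probability step law `ρ`
and every measurable `p > 0`: proposing `φ ↦ u + φ`, `u ∼ ρ`, and accepting with
`min {1, p(u + φ)/p(φ)}` is reversible for `p · μ` — whatever the step size `δ`. -/
theorem addWalkMH_isReversible [MeasurableNeg G] {μ : Measure G} [SFinite μ] [μ.IsAddLeftInvariant]
    {ρ : Measure G} [IsProbabilityMeasure ρ] [ρ.IsNegInvariant] {p : G → ℝ} (hp : Measurable p)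
    (hp0 : ∀ φ, 0 < p φ) :
    Kernel.IsReversible (symMH (addWalk ρ) p) (μ.withDensity fun φ => ENNReal.ofReal (p φ)) :=
  symMH_isReversible hp hp0 (compProd_addWalk_swap μ ρ)

/-- … and `p · μ` is invariant under the scalar-field site Metropolis update. -/
theorem addWalkMH_invariant [MeasurableNeg G] {μ : Measure G} [SFinite μ] [μ.IsAddLeftInvariant]
    {ρ : Measure G} [IsProbabilityMeasure ρ] [ρ.IsNegInvariant] {p : G → ℝ} (hp : Measurable p)
    (hp0 : ∀ φ, 0 < p φ) :
    Kernel.Invariant (symMH (addWalk ρ) p) (μ.withDensity fun φ => ENNReal.ofReal (p φ)) :=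
  symMH_invariant hp hp0 (compProd_addWalk_swap μ ρ)

end AddGroupWalk

end Summit.Ventures.LatticeQCDFlow.Exactness
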